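import Summits.BirchSwinnertonDyer.BirchSwinnertonDyer.Theorems.ManinLocalTwoThreeThreeHauptmodul
import Summits.BirchSwinnertonDyer.BirchSwinnertonDyer.Theorems.ManinLocalTwoThreeAdditiveIsogenyInvariant
import Literature.NumberTheory.EllipticCurves.IsogenyConductorModularityProofs
import Literature.NumberTheory.EllipticCurves.ModularParametrizationTrustBaseProofs
import Literature.NumberTheory.EllipticCurves.ModularParametrizationDegreeHoldsProofs
import HarnessLib

/-!
# THE NÉRON-SCALAR CLOCK LAW AT `3` (an's E-an-116 `ThreeNeronScalarClockLaw`) — BY VALUE, granted conductor invariance along the isogeny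

Summit `BirchSwinnertonDyer`, route `ManinLocalTwoThree` (cell bsd-f2-manin), crux C3 `ManinPrimeToThreeAtNine` (stmt-BirchSwinnertonDyer-22968).
an g25's charter answer at `3` (MEMO-an §67, Sketch-an-g25 :91 `ThreeNeronScalarClockLaw`; census 85 098 directed rational `3`-isogenies with additive
potentially good source, 0 violations): for `W/ℚ` globally minimal, additive and potentially good at `3` (`9 ∣ N`, `ord₃ j ≥ 0`), `q` with
`Ψ₃(q − b₂/12) = 0`, `K = K₃(W, C) = 2·(ord₃ Δ_min − 2·ord₃ D₀(x))` (`x = q − b₂/12`, `D₀ = threeSubgroupDisc W x = 4x³ + b₂x² + 2b₄x + b₆`),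
`m = m₃(W) = ord₃ Δ_min − ord₃ N + 1`:
**`K = 0 ⟹ u = 1`; `K = 12 ⟹ u = 3`; `1 ≤ K ≤ 11 ⟹ (u = 3 ⟺ m + K ≥ 13) ∧ (u = 1 ⟺ m + K ≤ 12)`**, «`u = 1`» = an's `VeluPairMinimal`
(a globally minimal curve carries `(A, B) = (1440q² − 9c₄, 60480q³ − 756c₄q − 27c₆)`), «`u = 3`» = `VeluPairThriceMinimal` (one carries `(3⁻⁴A, 3⁻⁶B)`).

PROOF (an's five-line proof, MEMO-an §67.2, every input a tree theorem except conductor invariance): p3-g7's ISOGENOUS carrier `(W′, κ)`, `κ ∣ 3`,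
`ord₃Δ_min(W′) = 3δ − 4·ord₃D₀ − 12·ord₃κ = δ + K − 12·ord₃κ` (`exists_isIsogenous_dvd_three_velu_three`, DD15 Thm 5); `9 ∣ N(W′)`
(`sq_dvd_conductorNorm_of_isIsogenous`); `W′` potentially good (`…ThreeHauptmodul`: `0 ≤ K ≤ 12` and the carrier lemma); the WINDOW `1 ≤ m ≤ 9` at
`3` for BOTH curves (S-an-42 `potGoodComponentWindowThree`, landed); `N(W′) = N(W)` (modularity); so `m′ = m + K − 12·ord₃κ ∈ [1, 9]` decides `ord₃κ`;
exclusivity `not_veluThreePair_minimal_and_thriceMinimal` gives the `⟺`.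

* `threeNeronScalarClockLaw_of_modularity` (hypothesis `nonempty_modularParametrizationData`), `threeNeronScalarClockLaw_of_exists_isNewformOf`
  (hypothesis `exists_isNewformOf` = the crux's fourth binder) — E-an-116 VERBATIM BY VALUE (an's `hauptK₃`, `threeSubgroupDisc`, `oggComponents`,
  `VeluPairMinimal`, `VeluPairThriceMinimal`, `veluC4/6` unfolded).

HONEST FRAMING: E-an-116 becomes a theorem MODULO conductor invariance along the `3`-isogeny (modularity here; Ogg–Saito would do).  C3, Manin's
conjecture and BSD are not proved.  No definitions, no named facts, no sorry.  References: [DokchitserDokchitser2015LocalInvariants] Thm. 5, Table 1;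
[SilvermanATAEC1994] IV.9.4, IV.11.1; [AtkinLehner1970] Thm. 4; [Kraus1990] Thm. 1.
-/

set_option linter.dupNamespace false
set_option autoImplicit false

noncomputable section

open scoped Classical

open WeierstrassCurve IsDedekindDomain IsLocalRing
  Literature.NumberTheory.DiophantineGeometry Literature.NumberTheory.DiophantineGeometry.TateAlgorithm
  Literature.NumberTheory.EllipticCurves Literature.NumberTheory.EllipticCurves.ModularForms

namespace Summit.BirchSwinnertonDyer.BirchSwinnertonDyer.Theorems.ManinLocalTwoThree

open NumberField Rat.HeightOneSpectrum Summit.BirchSwinnertonDyer.Rank1Residual.Additive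
  Summit.BirchSwinnertonDyer.Rank1Residual.ManinAdditive.TameThreeCharacter

/-- **E-an-116 `ThreeNeronScalarClockLaw`, BY VALUE, granted `nonempty_modularParametrizationData`** (conductor invariance along the `3`-isogeny).
[cite: DokchitserDokchitser2015LocalInvariants, Thm. 5 and Table 1] [cite: SilvermanATAEC1994, IV.9.4 Table 4.1 and IV.11.1] [cite: AtkinLehner1970, Thm. 4] -/
theorem threeNeronScalarClockLaw_of_modularity (hmod : nonempty_modularParametrizationData)
    (W : WeierstrassCurve ℚ) [W.IsElliptic] [W.IsGloballyMinimal] (h9 : 3 ^ 2 ∣ W.conductorNorm ℤ) (hj : 0 ≤ padicValRat 3 W.j)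
    (q : ℚ) (hq : W.Ψ₃.eval (q - W.b₂ / 12) = 0) :
    (2 * ((padicValInt 3 W.minimalDiscriminantInt : ℤ) -
          2 * padicValRat 3 (4 * (q - W.b₂ / 12) ^ 3 + W.b₂ * (q - W.b₂ / 12) ^ 2 + 2 * W.b₄ * (q - W.b₂ / 12) + W.b₆)) = 0 →
      ∃ W' : WeierstrassCurve ℚ, W'.IsElliptic ∧ W'.IsGloballyMinimal ∧
        W'.c₄ = 1440 * q ^ 2 - 9 * W.c₄ ∧ W'.c₆ = 60480 * q ^ 3 - 756 * W.c₄ * q - 27 * W.c₆) ∧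
    (2 * ((padicValInt 3 W.minimalDiscriminantInt : ℤ) -
          2 * padicValRat 3 (4 * (q - W.b₂ / 12) ^ 3 + W.b₂ * (q - W.b₂ / 12) ^ 2 + 2 * W.b₄ * (q - W.b₂ / 12) + W.b₆)) = 12 →
      ∃ W' : WeierstrassCurve ℚ, W'.IsElliptic ∧ W'.IsGloballyMinimal ∧
        (3 : ℚ) ^ 4 * W'.c₄ = 1440 * q ^ 2 - 9 * W.c₄ ∧ (3 : ℚ) ^ 6 * W'.c₆ = 60480 * q ^ 3 - 756 * W.c₄ * q - 27 * W.c₆) ∧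
    (1 ≤ 2 * ((padicValInt 3 W.minimalDiscriminantInt : ℤ) -
          2 * padicValRat 3 (4 * (q - W.b₂ / 12) ^ 3 + W.b₂ * (q - W.b₂ / 12) ^ 2 + 2 * W.b₄ * (q - W.b₂ / 12) + W.b₆)) →
      2 * ((padicValInt 3 W.minimalDiscriminantInt : ℤ) -
          2 * padicValRat 3 (4 * (q - W.b₂ / 12) ^ 3 + W.b₂ * (q - W.b₂ / 12) ^ 2 + 2 * W.b₄ * (q - W.b₂ / 12) + W.b₆)) ≤ 11 →
      ((∃ W' : WeierstrassCurve ℚ, W'.IsElliptic ∧ W'.IsGloballyMinimal ∧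
          (3 : ℚ) ^ 4 * W'.c₄ = 1440 * q ^ 2 - 9 * W.c₄ ∧ (3 : ℚ) ^ 6 * W'.c₆ = 60480 * q ^ 3 - 756 * W.c₄ * q - 27 * W.c₆) ↔
        13 ≤ (padicValInt 3 W.minimalDiscriminantInt : ℤ) - (padicValNat 3 (W.conductorNorm ℤ) : ℤ) + 1 +
          2 * ((padicValInt 3 W.minimalDiscriminantInt : ℤ) -
            2 * padicValRat 3 (4 * (q - W.b₂ / 12) ^ 3 + W.b₂ * (q - W.b₂ / 12) ^ 2 + 2 * W.b₄ * (q - W.b₂ / 12) + W.b₆))) ∧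
      ((∃ W' : WeierstrassCurve ℚ, W'.IsElliptic ∧ W'.IsGloballyMinimal ∧
          W'.c₄ = 1440 * q ^ 2 - 9 * W.c₄ ∧ W'.c₆ = 60480 * q ^ 3 - 756 * W.c₄ * q - 27 * W.c₆) ↔
        (padicValInt 3 W.minimalDiscriminantInt : ℤ) - (padicValNat 3 (W.conductorNorm ℤ) : ℤ) + 1 +
          2 * ((padicValInt 3 W.minimalDiscriminantInt : ℤ) -
            2 * padicValRat 3 (4 * (q - W.b₂ / 12) ^ 3 + W.b₂ * (q - W.b₂ / 12) ^ 2 + 2 * W.b₄ * (q - W.b₂ / 12) + W.b₆)) ≤ 12)) := by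
  haveI : Fact (Nat.Prime 3) := ⟨Nat.prime_three⟩
  haveI : PerfectField (IsLocalRing.ResidueField ((placeOf 3).adicCompletionIntegers ℚ)) := PerfectField.ofFinite
  -- `threeSubgroupDisc W x = Ψ₂²_W(x)`
  have hD : 4 * (q - W.b₂ / 12) ^ 3 + W.b₂ * (q - W.b₂ / 12) ^ 2 + 2 * W.b₄ * (q - W.b₂ / 12) + W.b₆ = W.Ψ₂Sq.eval (q - W.b₂ / 12) :=
    threeSubgroupDisc_eq_Ψ₂Sq_eval W (q - W.b₂ / 12)
  rw [hD]
  set D : ℚ := W.Ψ₂Sq.eval (q - W.b₂ / 12) with hDdef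
  set k : ℤ := (padicValInt 3 W.minimalDiscriminantInt : ℤ) - 2 * padicValRat 3 D with hkdef
  -- the range `0 ≤ k ≤ 6` and Ogg's `m` for `W`
  obtain ⟨hk0, hk6⟩ := hauptK₃_range_of_padicValRat_j_nonneg W q hq hj
  obtain ⟨hm, hadd⟩ := oggComponents_eq_numComponents_of_sq_dvd W 3 h9
  obtain ⟨hm1, hm9⟩ := potGoodComponentWindowThree W h9 hj
  -- the isogenous carrier
  obtain ⟨W', κ, hE', hM', hiso, hκ3, hκ0, h4', h6', hbook⟩ := exists_isIsogenous_dvd_three_velu_three W q hq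
  have hb := hbook 3
  rw [← hDdef] at hb
  have hκQ : (κ : ℚ) ≠ 0 := by exact_mod_cast hκ0
  have h9' : 3 ^ 2 ∣ W'.conductorNorm ℤ := sq_dvd_conductorNorm_of_isIsogenous 3 h9 hiso
  have hj' : 0 ≤ padicValRat 3 W'.j := padicValRat_j_nonneg_velu_three_carrier W q hq W' hκQ h4' h6' hk0 hk6
  obtain ⟨hm', -⟩ := oggComponents_eq_numComponents_of_sq_dvd W' 3 h9'
  obtain ⟨hm1', hm9'⟩ := potGoodComponentWindowThree W' h9' hj'
  have hN : W.conductorNorm ℤ = W'.conductorNorm ℤ := conductorNorm_eq_of_isIsogenous_of_modularity_of_isGloballyMinimal hmod hiso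
  rw [← hN] at hm' hm1' hm9'
  -- `κ ∈ {±1, ±3}`
  have hκcases : (padicValInt 3 κ = 0 ∧ (κ : ℚ) ^ 4 = 1 ∧ (κ : ℚ) ^ 6 = 1) ∨
      (padicValInt 3 κ = 1 ∧ (κ : ℚ) ^ 4 = 3 ^ 4 ∧ (κ : ℚ) ^ 6 = 3 ^ 6) := by
    have hκ3' : κ.natAbs ∣ 3 := by simpa using Int.natAbs_dvd_natAbs.mpr hκ3
    have hκ13 : κ.natAbs = 1 ∨ κ.natAbs = 3 := (Nat.dvd_prime Nat.prime_three).mp hκ3'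
    have hv3 : padicValInt 3 3 = 1 := padicValInt_self
    rcases hκ13 with h1 | h3
    · left
      rcases Int.natAbs_eq κ with h | h <;> rw [h1] at h <;> rw [h]
      · exact ⟨by simp [padicValInt], by push_cast; norm_num, by push_cast; norm_num⟩
      · exact ⟨by simp [padicValInt], by push_cast; norm_num, by push_cast; norm_num⟩
    · right
      rcases Int.natAbs_eq κ with h | h <;> rw [h3] at h <;> rw [h]
      · exact ⟨by exact_mod_cast hv3, by push_cast; norm_num, by push_cast; norm_num⟩
      · refine ⟨?_, by push_cast; norm_num, by push_cast; norm_num⟩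
        rw [show padicValInt 3 (-((3 : ℕ) : ℤ)) = padicValInt 3 3 from by simp [padicValInt]]; exact hv3
  have hmin_of : (κ : ℚ) ^ 4 = 1 → (κ : ℚ) ^ 6 = 1 →
      (∃ W' : WeierstrassCurve ℚ, W'.IsElliptic ∧ W'.IsGloballyMinimal ∧
        W'.c₄ = 1440 * q ^ 2 - 9 * W.c₄ ∧ W'.c₆ = 60480 * q ^ 3 - 756 * W.c₄ * q - 27 * W.c₆) := fun hk4 hk6 ↦
    ⟨W', hE', hM', by rw [← h4', hk4, one_mul], by rw [← h6', hk6, one_mul]⟩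
  have hthrice_of : (κ : ℚ) ^ 4 = 3 ^ 4 → (κ : ℚ) ^ 6 = 3 ^ 6 →
      (∃ W' : WeierstrassCurve ℚ, W'.IsElliptic ∧ W'.IsGloballyMinimal ∧
        (3 : ℚ) ^ 4 * W'.c₄ = 1440 * q ^ 2 - 9 * W.c₄ ∧ (3 : ℚ) ^ 6 * W'.c₆ = 60480 * q ^ 3 - 756 * W.c₄ * q - 27 * W.c₆) :=
    fun hk4 hk6 ↦ ⟨W', hE', hM', by rw [← h4', hk4], by rw [← h6', hk6]⟩
  have hexcl := not_veluThreePair_minimal_and_thriceMinimal (1440 * q ^ 2 - 9 * W.c₄) (60480 * q ^ 3 - 756 * W.c₄ * q - 27 * W.c₆)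
  refine ⟨fun hK0 ↦ ?_, fun hK12 ↦ ?_, fun hK1 hK11 ↦ ?_⟩
  · -- `K = 0`: `κ = ±3` would give `m′ = m − 12 < 1`
    rcases hκcases with ⟨he, hk4, hk6⟩ | ⟨he, hk4, hk6⟩
    · exact hmin_of hk4 hk6
    · exfalso; rw [he] at hb; push_cast at hb; linarith
  · -- `K = 12`: `κ = ±1` would give `m′ = m + 12 > 9`
    rcases hκcases with ⟨he, hk4, hk6⟩ | ⟨he, hk4, hk6⟩
    · exfalso; rw [he] at hb; push_cast at hb; linarith
    · exact hthrice_of hk4 hk6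
  · rcases hκcases with ⟨he, hk4, hk6⟩ | ⟨he, hk4, hk6⟩
    · -- `κ = ±1`: `m′ = m + K ≤ 9`; `u = 1` holds, `u = 3` fails by exclusivity
      rw [he] at hb; push_cast at hb
      have hmin := hmin_of hk4 hk6
      have hle : (padicValInt 3 W.minimalDiscriminantInt : ℤ) - (padicValNat 3 (W.conductorNorm ℤ) : ℤ) + 1 + 2 * k ≤ 12 := by linarith
      exact ⟨⟨fun hth ↦ absurd ⟨hmin, hth⟩ hexcl, fun h ↦ by linarith⟩, ⟨fun _ ↦ hle, fun _ ↦ hmin⟩⟩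
    · -- `κ = ±3`: `m′ = m + K − 12 ≥ 1`; `u = 3` holds, `u = 1` fails by exclusivity
      rw [he] at hb; push_cast at hb
      have hth := hthrice_of hk4 hk6
      have hge : 13 ≤ (padicValInt 3 W.minimalDiscriminantInt : ℤ) - (padicValNat 3 (W.conductorNorm ℤ) : ℤ) + 1 + 2 * k := by linarith
      exact ⟨⟨fun _ ↦ hge, fun _ ↦ hth⟩, ⟨fun hmn ↦ absurd ⟨hmn, hth⟩ hexcl, fun h ↦ by linarith⟩⟩

/-- **E-an-116 `ThreeNeronScalarClockLaw`, BY VALUE, granted the Modularity Theorem `exists_isNewformOf`** (the crux's fourth binder `hnf`).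
[cite: DokchitserDokchitser2015LocalInvariants, Thm. 5 and Table 1] [cite: DiamondShurman2005, Thm. 8.8.3] -/
theorem threeNeronScalarClockLaw_of_exists_isNewformOf (hnf : exists_isNewformOf)
    (W : WeierstrassCurve ℚ) [W.IsElliptic] [W.IsGloballyMinimal] (h9 : 3 ^ 2 ∣ W.conductorNorm ℤ) (hj : 0 ≤ padicValRat 3 W.j)
    (q : ℚ) (hq : W.Ψ₃.eval (q - W.b₂ / 12) = 0) :
    (2 * ((padicValInt 3 W.minimalDiscriminantInt : ℤ) -
          2 * padicValRat 3 (4 * (q - W.b₂ / 12) ^ 3 + W.b₂ * (q - W.b₂ / 12) ^ 2 + 2 * W.b₄ * (q - W.b₂ / 12) + W.b₆)) = 0 →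
      ∃ W' : WeierstrassCurve ℚ, W'.IsElliptic ∧ W'.IsGloballyMinimal ∧
        W'.c₄ = 1440 * q ^ 2 - 9 * W.c₄ ∧ W'.c₆ = 60480 * q ^ 3 - 756 * W.c₄ * q - 27 * W.c₆) ∧
    (2 * ((padicValInt 3 W.minimalDiscriminantInt : ℤ) -
          2 * padicValRat 3 (4 * (q - W.b₂ / 12) ^ 3 + W.b₂ * (q - W.b₂ / 12) ^ 2 + 2 * W.b₄ * (q - W.b₂ / 12) + W.b₆)) = 12 →
      ∃ W' : WeierstrassCurve ℚ, W'.IsElliptic ∧ W'.IsGloballyMinimal ∧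
        (3 : ℚ) ^ 4 * W'.c₄ = 1440 * q ^ 2 - 9 * W.c₄ ∧ (3 : ℚ) ^ 6 * W'.c₆ = 60480 * q ^ 3 - 756 * W.c₄ * q - 27 * W.c₆) ∧
    (1 ≤ 2 * ((padicValInt 3 W.minimalDiscriminantInt : ℤ) -
          2 * padicValRat 3 (4 * (q - W.b₂ / 12) ^ 3 + W.b₂ * (q - W.b₂ / 12) ^ 2 + 2 * W.b₄ * (q - W.b₂ / 12) + W.b₆)) →
      2 * ((padicValInt 3 W.minimalDiscriminantInt : ℤ) -
          2 * padicValRat 3 (4 * (q - W.b₂ / 12) ^ 3 + W.b₂ * (q - W.b₂ / 12) ^ 2 + 2 * W.b₄ * (q - W.b₂ / 12) + W.b₆)) ≤ 11 →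
      ((∃ W' : WeierstrassCurve ℚ, W'.IsElliptic ∧ W'.IsGloballyMinimal ∧
          (3 : ℚ) ^ 4 * W'.c₄ = 1440 * q ^ 2 - 9 * W.c₄ ∧ (3 : ℚ) ^ 6 * W'.c₆ = 60480 * q ^ 3 - 756 * W.c₄ * q - 27 * W.c₆) ↔
        13 ≤ (padicValInt 3 W.minimalDiscriminantInt : ℤ) - (padicValNat 3 (W.conductorNorm ℤ) : ℤ) + 1 +
          2 * ((padicValInt 3 W.minimalDiscriminantInt : ℤ) -
            2 * padicValRat 3 (4 * (q - W.b₂ / 12) ^ 3 + W.b₂ * (q - W.b₂ / 12) ^ 2 + 2 * W.b₄ * (q - W.b₂ / 12) + W.b₆))) ∧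
      ((∃ W' : WeierstrassCurve ℚ, W'.IsElliptic ∧ W'.IsGloballyMinimal ∧
          W'.c₄ = 1440 * q ^ 2 - 9 * W.c₄ ∧ W'.c₆ = 60480 * q ^ 3 - 756 * W.c₄ * q - 27 * W.c₆) ↔
        (padicValInt 3 W.minimalDiscriminantInt : ℤ) - (padicValNat 3 (W.conductorNorm ℤ) : ℤ) + 1 +
          2 * ((padicValInt 3 W.minimalDiscriminantInt : ℤ) -
            2 * padicValRat 3 (4 * (q - W.b₂ / 12) ^ 3 + W.b₂ * (q - W.b₂ / 12) ^ 2 + 2 * W.b₄ * (q - W.b₂ / 12) + W.b₆)) ≤ 12)) :=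
  threeNeronScalarClockLaw_of_modularity
    (nonempty_modularParametrizationData_of_exists_isNewformOf hnf IsNewformOf.exists_maninConstant_ne_zero_holds) W h9 hj q hq

end Summit.BirchSwinnertonDyer.BirchSwinnertonDyer.Theorems.ManinLocalTwoThree

end
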